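import Summits.QuantumFields.YangMills.Theorems.UnitScaleTiltProp7CornerCombCellTheoremMember
import Summits.QuantumFields.YangMills.Theorems.UnitScaleTiltProp7CornerCombLambdaClosureSharp
import HarnessLib

/-!
# Route `UnitScaleTilt`, crux K1 «MinimiserStabilityRegPr» (stmt-QuantumFields-19200), lane II (R-LEGS) ∕ route-R (β) (n3)-comb (II) —
# FILE F-9d-a «THE SOURCELESS CELL ROWS OF THE LINEAR-RESPONSE COMB TOWER»: LEVEL MASS (TWO SLOTS) AND LEVEL COVARIANT GRADIENT (PURE B-SLOT)
# OF `Q l Y` OVER A PERIOD CELL, THE SOURCELESS GAUGE ROW DISPLAYED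

Cell `ym3-torus`, width seat `ym3-torus-px18` (gen 5); pen F-9d ≡ F-8′ (★routeR-w1 g10 12:29:20Z; (a)(b) px18 g5, (c) member file ★routeR-w2 g10); consumer =
⧗p718441 `Prop7RLegsCovKnit.covGradLegs_of_linTower_rows (hG) (hN′)` (w4-20520 g12 SPEC #58∕#59) → px19 g7 `hEng_of_rlegs` (the EX face row `hEng`).
THEOREMS ONLY (0 `def`, 0 `sorry`); `--supports stmt-QuantumFields-19200 --as helper`, count-neutral.  YM₃ on T³ is a ladder rung (R3), not the Clay problem;
nothing here claims (hG), (hN′), `rlegs`, `hEng`, `hMcomb`, (β), the stub, the crux, d = 4 or the mass gap.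

THE POINT (LOCATE #61 `ym3-torus-px18/g5/LOCATE-F9d-LINTOWER-ROWS-px18g5.md`; ★routeR-w2 g10 LOCATE #62 for the member side).  The linear-response tower
`Y_l = D[Ũˡ(W♯,(eᵗᴬ)♯)]·A = Q l (A♯)` (✓`fderiv_coe_tildIter_eq_linTower_pull_of_regPr`) is a SOURCELESS comb tower: `Q (j+1) Y = T_j(Q j Y)` exactly (✓p704390
`exists_linTower_family`), so the F-8b cell machinery applies at `N ≡ 0`, `σ ≡ 0` with an ARBITRARY `N′Lᵏ`-periodic datum `Y`: the structure identity
`Q j Y = G_j + ∇^{cov}Λ_j` (✓F-4 `cornerComb_structure`), the sourceless mass and gradient lines of ✓F-8b-2 (`sqrt_mass_lin_step_le`, `sqrt_grad_lin_step_le`,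
`sqrt_mass_full_le` at `Nn := 0`), periodicity by ✓F-8b-1 `isPeriodic_sourced_families` at `rem := 0`, and the anchored scalar closure ✓F-9a at `θ₂ = wN = wS = 0`
(`Qn♯ = 0`; the gauge row has NO feedback).  CONCLUSION ★★★ `sum_cell_linTower_rows`: under F-8b-4 v2's binder list MINUS the sourced letters
{`U₁ hU₁ hTu μ hμ0 hμ72 hμ Nn rem hrem hN0 hNn n hn θ₂ wN wS cB1 hσgeo hsmall hsmallS hcB1sq`} PLUS {`Y hYper`, `Q hQ0 hQs` (✓p704390's text), the sourceless gauge row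
`hrow₀ : λ_j² ≤ Σ_{i<j}(ρ⁻¹)^{j−i}·(wG·g_i² + wM_i·m_i²)`}, for every `l ≤ k`:
MASS `Σ_{t,κ}‖Q l Y (boxVec t) κ‖² ≤ 2·(e′m₀)²·(ρˡ)² + 2·(cB0 + cA·ρ^{2k})²·((ρ⁻¹)ˡ)²` and GRADIENT
`Σ_{t,κ,ν}‖Ad_{Ūˡ(t̂,ν)}(Q l Y (t̂+e_ν) κ) − Q l Y t̂ κ‖² ≤ (2·Ĝ² + 8d·(cB0 + cA·ρ^{2k})²)·((ρ⁻¹)ˡ)²`, `Ĝ = g₀ + θ_g·e′·m₀·ρ^{2k}·ρ³∕(1−ρ²)`, `e′ = exp(θ′ρ³∕(1−ρ⁴))`,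
`m₀² = MASS₀(Y)`, `g₀² = GRADcov₀(Y)`; on `T³` (`(ρˡ)² = L^{−l}`, `((ρ⁻¹)ˡ)² = Lˡ`, `ρ^{2k} = ℓ⁻¹`) with `cB0² = 2wGĜ²ρ∕(1−ρ)`, `cA² = 2ΘM(e′m₀)²ρ∕(1−ρ)` these are
(hN′) `CN·L^{−l}·SA + CN′·Lˡ·GA + CN″·e²·Lˡ·ℓ⁻²·SA` and (hG) `CG·Lˡ·GA + CG′·e²·Lˡ·ℓ⁻²·SA` — w4's SPEC shape in its stated tolerance (`w(e)·Lˡ·ℓ⁻²·SA` windows; the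
filed `e²L^{3l}ℓ⁻⁴` needs the `ρ^{8(k−i)}` gauge-row window, a follow-up).  ★ `sum_cell_covGrad_dir_le_of_sum` reads one coarse direction off the summed gradient ((hG) is per `μ`).
HONEST SCOPE.  Assembly only; `d` general with `√(L²L⁻ᵈ) = ρ`, `√(L⁴L⁻ᵈ) = ρ⁻¹` as hypotheses; every window∕constant row and `hrow₀` are hypotheses (F-9d-b inhabits
`hrow₀` from ★routeR-w6's F-6d-3′; F-9d-c = ★routeR-w2's member file reads the windows off `RegPr` by ✓F-8c-3a and the letters by ✓F-8c-final-1a).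

References: T. Bałaban, CMP **109** (1987) 249–301 [Balaban1987RG1] ((0.1), (0.4) pp.251–253); CMP **98** (1985) 17–51 [Balaban1985Averaging] ((42)–(43), (68)–(69),
Prop. 3 (122)–(126)); CMP **102** (1985) 277–309 [Balaban1985Variational] ((2), (106)–(111) p.294: the linearised averaging tower and its `(Lˡ)⁻¹`∕`Lˡ` currency).
-/

set_option autoImplicit false

noncomputable section

open scoped BigOperators
open Finset

namespace Summit.QuantumFields.YangMills.Theorems.Prop7CornerCombLinTowerCellRows

open NormedSpace
open Literature.MathematicalPhysics.QuantumFieldTheory.Balaban1983to89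
open ExpMeanLog (eml)
open B7Prop1Explicit renaming Site → LSite
open B7Prop1Explicit (Letter e hol seg boxVec gammaWord plaqWord Wcx Xavg bavg expUnit U1)
open B7Prop2Explicit (avgIter unitaryUnits unitaryUnits_le_U1)
open B7Eq78Linearization (conjR)
open B7Prop3GeneralRotated (tsum)
open B7Prop3GeneralLinear (FhatCov)
open T4TermwiseTorus (IsPeriodic)
open Summit.QuantumFields.YangMills.Theorems.Prop7CombPeriodCellDict (isPeriodic_avgIter)
open Summit.QuantumFields.YangMills.Theorems.Prop7CornerCombStructure (cornerComb_structure)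
open Summit.QuantumFields.YangMills.Theorems.Prop7CornerCombFamiliesPeriodic (isPeriodic_sourced_families apply_add_period_of_isPeriodic
  apply_add_period_of_isPeriodic' period_tower_step)
open Summit.QuantumFields.YangMills.Theorems.Prop7CornerCombLinesInhabited (sqrt_mass_lin_step_le sqrt_grad_lin_step_le sqrt_mass_full_le sum_cell_covGrad_add_le)
open Summit.QuantumFields.YangMills.Theorems.Prop7CornerCombLambdaClosure (sq_le_two_slot)
open Summit.QuantumFields.YangMills.Theorems.Prop7CornerCombLevelInduction (mass_line_le_geom)
open Summit.QuantumFields.YangMills.Theorems.Prop7CornerCombLambdaClosureSharp (n_lam_B_slot_of_rows grad_full_B_slot_of_rows)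
open Summit.QuantumFields.YangMills.Theorems.Prop7CornerCombCellTheoremMember (sum_boxVec_congr avgIter_isPeriodic_level)

variable {d : ℕ} {𝔸 : Type*} [CStarAlgebra 𝔸]

/-! ## §1 Bookkeeping -/

/-- One coarse direction of a covariant-gradient cell sum is below the sum over directions ((hG) is stated per direction `μ`). [folklore] -/
theorem sum_cell_covGrad_dir_le_of_sum {M : ℕ} (V : LSite d → Fin d → 𝔸ˣ) (X : LSite d → Fin d → 𝔸) {R : ℝ}
    (h : ∑ t : Fin d → Fin M, ∑ κ : Fin d, ∑ ν : Fin d, ‖conjR (V (boxVec M t) ν) (X (boxVec M t + e ν) κ) - X (boxVec M t) κ‖ ^ 2 ≤ R) (ν : Fin d) :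
    ∑ t : Fin d → Fin M, ∑ κ : Fin d, ‖conjR (V (boxVec M t) ν) (X (boxVec M t + e ν) κ) - X (boxVec M t) κ‖ ^ 2 ≤ R := by
  refine le_trans (Finset.sum_le_sum fun t _ => Finset.sum_le_sum fun κ _ => ?_) h
  exact Finset.single_le_sum (f := fun ν' => ‖conjR (V (boxVec M t) ν') (X (boxVec M t + e ν') κ) - X (boxVec M t) κ‖ ^ 2)
    (fun _ _ => sq_nonneg _) (Finset.mem_univ ν)

/-! ## §2 ★★★ The sourceless cell rows of the linear-response tower (the sourceless gauge row displayed) -/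

variable [Nontrivial 𝔸]

-- hb: the F-8b-4-size binder list + the level-by-level inhabitation (README HEARTBEAT BUDGET rule: decl-local, never file-global)
set_option maxHeartbeats 400000 in
/-- ★★★ **THE SOURCELESS CELL ROWS OF THE LINEAR-RESPONSE COMB TOWER.**  Data: `N′Lᵏ`-periodic unitary-valued `U₀`; an `N′Lᵏ`-periodic datum `Y`; a linTower family `Q`
(`hQ0`, `hQs` — ✓p704390's recursion); its reduced family `Glin` and gauge function `Λ` (`hG0 hΛ0 hGlin hΛs`, ✓`exists_reduced_gauge_family`); level windows
(unitarity of `Ūʲ`, block loops `α_j ≤ 1∕24`, plaquettes `a_j`) and the scalar letters `θ′ θ_g ΘM wG cA cB0 wM` with their rows; the SOURCELESS gauge row `hrow₀`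
DISPLAYED in the cell letters `m g lam`.  CONCLUSION: for every `l ≤ k`, the MASS of `Q l Y` over the level cell in two slots AND its COVARIANT GRADIENT in the pure B-slot
(module docstring). [cite: Balaban1987RG1, (0.1), (0.4) pp.251–253; Balaban1985Variational, (106)–(111) p.294; Balaban1985Averaging, Prop. 3 (122)–(126) p.36] -/
theorem sum_cell_linTower_rows (L N' k : ℕ) (hL : 1 ≤ L) (hN' : 0 < N') (U₀ : LSite d → Fin d → 𝔸ˣ)
    (hU₀ : IsPeriodic (N' * L ^ k) U₀)
    (hVu : ∀ j ≤ k, ∀ x μ, avgIter L U₀ j x μ ∈ unitaryUnits 𝔸)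
    (α a : ℕ → ℝ) (hα0 : ∀ j, 0 ≤ α j) (hα24 : ∀ j < k, α j ≤ 1 / 24)
    (hα : ∀ j < k, ∀ (z : LSite d) (κ : Fin d) (r : Fin d → Fin L), ‖((Wcx L (avgIter L U₀ j) ((L : ℤ) • z) κ (boxVec L r) : 𝔸ˣ) : 𝔸) - 1‖ ≤ α j)
    (ha0 : ∀ j, 0 ≤ a j) (hplaq : ∀ j < k, ∀ (x : LSite d) (κ' μ' : Fin d), κ' ≠ μ' → ‖((hol (avgIter L U₀ j) x (plaqWord κ' μ') : 𝔸ˣ) : 𝔸) - 1‖ ≤ a j)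
    (Y : LSite d → Fin d → 𝔸) (hYper : IsPeriodic (N' * L ^ k) Y)
    (Q : ℕ → (LSite d → Fin d → 𝔸) → LSite d → Fin d → 𝔸) (hQ0 : Q 0 Y = Y)
    (hQs : ∀ (j : ℕ) (z : LSite d) (κ : Fin d), Q (j + 1) Y z κ
      = fderiv ℂ (eml : ((Fin d → Fin L) → 𝔸) → 𝔸) (fun r => ((Wcx L (avgIter L U₀ j) ((L : ℤ) • z) κ (boxVec L r) : 𝔸ˣ) : 𝔸))
            (fun r => tsum (avgIter L U₀ j) (Q j Y) ((L : ℤ) • z) (gammaWord L κ (boxVec L r) ++ seg κ (-(L : ℤ)))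
              * ((Wcx L (avgIter L U₀ j) ((L : ℤ) • z) κ (boxVec L r) : 𝔸ˣ) : 𝔸))
            * (((expUnit (Xavg L (avgIter L U₀ j) ((L : ℤ) • z) κ))⁻¹ : 𝔸ˣ) : 𝔸)
          + ((expUnit (Xavg L (avgIter L U₀ j) ((L : ℤ) • z) κ) : 𝔸ˣ) : 𝔸) * tsum (avgIter L U₀ j) (Q j Y) ((L : ℤ) • z) (seg κ (L : ℤ))
            * (((expUnit (Xavg L (avgIter L U₀ j) ((L : ℤ) • z) κ))⁻¹ : 𝔸ˣ) : 𝔸))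
    (Glin : ℕ → LSite d → Fin d → 𝔸) (Λ : ℕ → LSite d → 𝔸)
    (hG0 : Glin 0 = Y) (hΛ0 : ∀ z, Λ 0 z = 0)
    (hGlin : ∀ (j : ℕ) (z : LSite d) (κ : Fin d), Glin (j + 1) z κ
      = (fderiv ℂ (eml : ((Fin d → Fin L) → 𝔸) → 𝔸) (fun r => ((Wcx L (avgIter L U₀ j) ((L : ℤ) • z) κ (boxVec L r) : 𝔸ˣ) : 𝔸))
            (fun r => tsum (avgIter L U₀ j) (Glin j) ((L : ℤ) • z) (gammaWord L κ (boxVec L r) ++ seg κ (-(L : ℤ)))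
              * ((Wcx L (avgIter L U₀ j) ((L : ℤ) • z) κ (boxVec L r) : 𝔸ˣ) : 𝔸))
            * (((expUnit (Xavg L (avgIter L U₀ j) ((L : ℤ) • z) κ))⁻¹ : 𝔸ˣ) : 𝔸)
          + ((expUnit (Xavg L (avgIter L U₀ j) ((L : ℤ) • z) κ) : 𝔸ˣ) : 𝔸) * tsum (avgIter L U₀ j) (Glin j) ((L : ℤ) • z) (seg κ (L : ℤ))
            * (((expUnit (Xavg L (avgIter L U₀ j) ((L : ℤ) • z) κ))⁻¹ : 𝔸ˣ) : 𝔸))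
        - (FhatCov L (avgIter L U₀ j) (Glin j) ((L : ℤ) • z) - conjR (avgIter L U₀ (j + 1) z κ) (FhatCov L (avgIter L U₀ j) (Glin j) ((L : ℤ) • (z + e κ)))))
    (hΛs : ∀ (j : ℕ) (z : LSite d), Λ (j + 1) z = FhatCov L (avgIter L U₀ j) (Glin j) ((L : ℤ) • z) + Λ j ((L : ℤ) • z))
    (m g y lam : ℕ → ℝ)
    (hm : ∀ j, m j = Real.sqrt (∑ t : Fin d → Fin (N' * L ^ (k - j)), ∑ μ' : Fin d, ‖Glin j (boxVec (N' * L ^ (k - j)) t) μ'‖ ^ 2))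
    (hy : ∀ j, y j = Real.sqrt (∑ t : Fin d → Fin (N' * L ^ (k - j)), ∑ μ' : Fin d, ‖Q j Y (boxVec (N' * L ^ (k - j)) t) μ'‖ ^ 2))
    (hg : ∀ j, g j = Real.sqrt (∑ t : Fin d → Fin (N' * L ^ (k - j)), ∑ κ : Fin d, ∑ ν : Fin d,
      ‖conjR (avgIter L U₀ j (boxVec (N' * L ^ (k - j)) t) ν) (Glin j (boxVec (N' * L ^ (k - j)) t + e ν) κ) - Glin j (boxVec (N' * L ^ (k - j)) t) κ‖ ^ 2))
    (hlam : ∀ j, lam j = Real.sqrt (∑ t : Fin d → Fin (N' * L ^ (k - j)), ∑ κ : Fin d,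
      ‖Λ j (boxVec (N' * L ^ (k - j)) t) - conjR (avgIter L U₀ j (boxVec (N' * L ^ (k - j)) t) κ) (Λ j (boxVec (N' * L ^ (k - j)) t + e κ))‖ ^ 2))
    {ρ θ' θg ΘM wG cA cB0 : ℝ} (hρ0 : 0 < ρ) (hρ1 : ρ < 1)
    (hρm : Real.sqrt ((L : ℝ) ^ 2 * ((L : ℝ) ^ d)⁻¹) = ρ) (hρg : Real.sqrt ((L : ℝ) ^ 4 * ((L : ℝ) ^ d)⁻¹) = ρ⁻¹)
    (hθ' : 0 ≤ θ') (hθg : 0 ≤ θg) (hΘM : 0 ≤ ΘM) (hwG : 0 ≤ wG) (hcA : 0 ≤ cA) (hcB0 : 0 ≤ cB0)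
    (wM : ℕ → ℝ) (hwM0 : ∀ j, 0 ≤ wM j) (hwMgeo : ∀ j < k, wM j ≤ ΘM * ρ ^ (4 * (k - j)))
    (hκgeo : ∀ j < k, 210 * ((2 * d + 2) * L) * α j * Real.sqrt (2 * d) ≤ θ' * ρ ^ (4 * (k - j)))
    (hKgeo : ∀ j < k, (24 * α j + 8 * (((d : ℝ) + 2) * L) ^ 2 * a j) * Real.sqrt (d * ((L : ℝ) ^ 2 * ((L : ℝ) ^ d)⁻¹))
      + 210 * ((2 * d + 2) * L) * α j * Real.sqrt (8 * (d : ℝ) ^ 2) ≤ θg * ρ ^ (4 * (k - j)))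
    (hrow₀ : ∀ j ≤ k, lam j ^ 2 ≤ ∑ i ∈ Finset.range j, (ρ⁻¹) ^ (j - i) * (wG * g i ^ 2 + wM i * m i ^ 2))
    (hcB0sq : 2 * wG * (g 0 + θg * Real.exp (θ' * (ρ ^ 3 / (1 - ρ ^ 4))) * m 0 * ρ ^ (2 * k) * (ρ ^ 3 / (1 - ρ ^ 2))) ^ 2 * (ρ / (1 - ρ)) ≤ cB0 ^ 2)
    (hcAsq : 2 * (ΘM * (Real.exp (θ' * (ρ ^ 3 / (1 - ρ ^ 4))) * m 0) ^ 2) * (ρ / (1 - ρ)) ≤ cA ^ 2) :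
    ∀ l ≤ k,
      (∑ t : Fin d → Fin (N' * L ^ (k - l)), ∑ κ : Fin d, ‖Q l Y (boxVec (N' * L ^ (k - l)) t) κ‖ ^ 2
          ≤ 2 * ((Real.exp (θ' * (ρ ^ 3 / (1 - ρ ^ 4))) * m 0) ^ 2 * (ρ ^ l) ^ 2) + 2 * ((cB0 + cA * ρ ^ (2 * k)) ^ 2 * ((ρ⁻¹) ^ l) ^ 2))
      ∧ (∑ t : Fin d → Fin (N' * L ^ (k - l)), ∑ κ : Fin d, ∑ ν : Fin d,
            ‖conjR (avgIter L U₀ l (boxVec (N' * L ^ (k - l)) t) ν) (Q l Y (boxVec (N' * L ^ (k - l)) t + e ν) κ) - Q l Y (boxVec (N' * L ^ (k - l)) t) κ‖ ^ 2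
          ≤ (2 * (g 0 + θg * Real.exp (θ' * (ρ ^ 3 / (1 - ρ ^ 4))) * m 0 * ρ ^ (2 * k) * (ρ ^ 3 / (1 - ρ ^ 2))) ^ 2 + 8 * d * (cB0 + cA * ρ ^ (2 * k)) ^ 2) * ((ρ⁻¹) ^ l) ^ 2) := by
  -- periods
  set Nc : ℕ → ℕ := fun j => N' * L ^ (k - j) with hNc
  have hL0 : 0 < L := hL
  have hNc0 : ∀ j, 0 < Nc j := fun j => by simp only [hNc]; positivity
  have hNcs : ∀ j < k, Nc j = Nc (j + 1) * L := fun j hj => by simp only [hNc]; exact period_tower_step N' L k j hj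
  -- periodicity of the level objects (✓F-8a, ✓F-8b-1 at `rem := 0`)
  have hVper : ∀ j ≤ k, IsPeriodic (Nc j) (avgIter L U₀ j) := fun j hj => avgIter_isPeriodic_level L N' k hU₀ hj
  have hGlper : ∀ j ≤ k, IsPeriodic (Nc j) (Glin j) ∧ IsPeriodic (Nc j) (Λ j) :=
    isPeriodic_sourced_families L Nc k hNcs (fun j => avgIter L U₀ j) hVper (fun _ _ _ => 0) (fun _ _ _ _ => rfl) Glin Λ
      (by rw [hG0]; exact hYper) hΛ0 (fun j z κ => by rw [hGlin, add_zero]) hΛs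
  -- the structure identity (✓F-4) below the unit loop window
  have hW : ∀ j < k, ∀ (z : LSite d) (κ : Fin d) (r : Fin d → Fin L), ‖((Wcx L (avgIter L U₀ j) ((L : ℤ) • z) κ (boxVec L r) : 𝔸ˣ) : 𝔸) - 1‖ < 1 :=
    fun j hj z κ r => (hα j hj z κ r).trans_lt (by linarith [hα24 j hj])
  have hstruct := cornerComb_structure L U₀ Y k hW Q hQ0 hQs (fun j X y => FhatCov L (avgIter L U₀ j) X ((L : ℤ) • y)) Glin Λ hG0 hΛ0
    (fun j z κ => hGlin j z κ) hΛs
  -- nonnegativity of the letters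
  have hm0' : ∀ j, 0 ≤ m j := fun j => by rw [hm]; exact Real.sqrt_nonneg _
  have hg0' : ∀ j, 0 ≤ g j := fun j => by rw [hg]; exact Real.sqrt_nonneg _
  have hy0' : ∀ j, 0 ≤ y j := fun j => by rw [hy]; exact Real.sqrt_nonneg _
  have hlam0 : ∀ j, 0 ≤ lam j := fun j => by rw [hlam]; exact Real.sqrt_nonneg _
  -- coordinate periodicity at the fine period `Nc (j+1) * L`
  have hcoord : ∀ {X : LSite d → Fin d → 𝔸} {j : ℕ}, j < k → IsPeriodic (Nc j) X →
      ∀ (x : LSite d) (κ μ' : Fin d), X (x + ((Nc (j + 1) * L : ℕ) : ℤ) • e κ) μ' = X x μ' := by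
    intro X j hj hX x κ μ'
    rw [← hNcs j hj]; exact apply_add_period_of_isPeriodic hX x κ μ'
  have hcoordU : ∀ {j : ℕ}, j < k → ∀ (x : LSite d) (κ μ' : Fin d),
      avgIter L U₀ j (x + ((Nc (j + 1) * L : ℕ) : ℤ) • e κ) μ' = avgIter L U₀ j x μ' := by
    intro j hj x κ μ'
    rw [← hNcs j hj]; exact apply_add_period_of_isPeriodic (hVper j hj.le) x κ μ'
  -- ★ the sourceless rows, level by level (✓F-8b-2)
  have hmrec : ∀ j < k, m (j + 1) ≤ (ρ + 210 * ((2 * d + 2) * L) * α j * Real.sqrt (2 * d)) * m j := by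
    intro j hj
    haveI : NeZero (Nc (j + 1)) := ⟨(hNc0 (j + 1)).ne'⟩
    have h := sqrt_mass_lin_step_le L (Nc (j + 1)) hL U₀ j (hVu j hj.le) (Glin j) (Glin (j + 1)) (hcoord hj (hGlper j hj.le).1) (hα0 j) (hα24 j hj)
      (fun z κ r => hα j hj _ κ r) (hGlin j)
    rw [hρm, sum_boxVec_congr (hNcs j hj).symm (fun x => ∑ ν : Fin d, ‖Glin j x ν‖ ^ 2)] at h
    rw [hm, hm]; exact h
  have hgrec : ∀ j < k, g (j + 1) ≤ ρ⁻¹ * g j + ((24 * α j + 8 * (((d : ℝ) + 2) * L) ^ 2 * a j) * Real.sqrt (d * ((L : ℝ) ^ 2 * ((L : ℝ) ^ d)⁻¹))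
      + 210 * ((2 * d + 2) * L) * α j * Real.sqrt (8 * (d : ℝ) ^ 2)) * m j := by
    intro j hj
    haveI : NeZero (Nc (j + 1)) := ⟨(hNc0 (j + 1)).ne'⟩
    have h := sqrt_grad_lin_step_le L (Nc (j + 1)) hL U₀ j (hVu j hj.le) (hcoordU hj) (ha0 j) (hplaq j hj) (hα0 j) (hα24 j hj) (hα j hj)
      (Glin j) (Glin (j + 1)) (hcoord hj (hGlper j hj.le).1) (hGlin j)
    rw [hρg, sum_boxVec_congr (hNcs j hj).symm (fun x => ∑ κ : Fin d, ∑ ν : Fin d, ‖conjR (avgIter L U₀ j x ν) (Glin j (x + e ν) κ) - Glin j x κ‖ ^ 2),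
      sum_boxVec_congr (hNcs j hj).symm (fun x => ∑ ν : Fin d, ‖Glin j x ν‖ ^ 2)] at h
    rw [hg, hg, hm]; exact h
  have hyle : ∀ j ≤ k, y j ≤ m j + (fun _ : ℕ => (0 : ℝ)) j + lam j := by
    intro j hj
    have h := sqrt_mass_full_le (Nc j) (avgIter L U₀ j) (Q j Y) (Glin j) (fun _ _ => 0) (Λ j) (fun z κ => by
      have := hstruct j hj z κ; rw [add_zero]; exact this)
    have h0 : Real.sqrt (∑ t : Fin d → Fin (Nc j), ∑ κ : Fin d, ‖(fun _ _ => (0 : 𝔸) : LSite d → Fin d → 𝔸) (boxVec (Nc j) t) κ‖ ^ 2) = 0 := by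
      simp
    rw [h0] at h
    rw [hy, hm, hlam]; exact h
  -- ★ the sourceless gauge row in F-9a's letters (`n = σ = 0`)
  have hrow : ∀ j ≤ k, lam j ^ 2 ≤ ∑ i ∈ Finset.range j, (ρ⁻¹) ^ (j - i)
      * (wG * g i ^ 2 + 0 * (fun _ : ℕ => (0 : ℝ)) i ^ 2 + wM i * (m i ^ 2 + (fun _ : ℕ => (0 : ℝ)) i ^ 2)
        + 0 * (fun _ : ℕ => (0 : ℝ)) i ^ 2 * (m i + (fun _ : ℕ => (0 : ℝ)) i + lam i) ^ 2) := by
    intro j hj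
    refine (hrow₀ j hj).trans (le_of_eq (Finset.sum_congr rfl fun i _ => ?_))
    ring
  -- ★ the anchored scalar closure (✓F-9a) at `θ₂ = wN = wS = 0`
  have hρ5 : ρ ^ 5 < 1 := pow_lt_one₀ hρ0.le hρ1 (by norm_num)
  have h15 : 0 < 1 - ρ ^ 5 := by linarith
  obtain ⟨cB1, hcB1, hcB1sq⟩ : ∃ c : ℝ, 0 ≤ c ∧ 2 * (0 * (ρ / (1 - ρ)) + (ΘM + 3 * 0 * (0 : ℝ) ^ 2) * (ρ ^ 5 / (1 - ρ ^ 5))) ≤ c ^ 2 :=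
    ⟨Real.sqrt (2 * (ΘM * (ρ ^ 5 / (1 - ρ ^ 5)))), Real.sqrt_nonneg _, by
      rw [Real.sq_sqrt (by positivity)]; exact le_of_eq (by ring)⟩
  have hcAsq' : 2 * ((ΘM + 3 * 0 * (0 : ℝ) ^ 2) * (Real.exp (θ' * (ρ ^ 3 / (1 - ρ ^ 4))) * m 0) ^ 2) * (ρ / (1 - ρ)) ≤ cA ^ 2 := by
    have e0 : ΘM + 3 * 0 * (0 : ℝ) ^ 2 = ΘM := by ring
    rw [e0]; exact hcAsq
  have hsmall : Real.exp (θ' * (ρ ^ 3 / (1 - ρ ^ 4))) * 0 * (1 + cB1) * (ρ ^ 3 / (1 - ρ ^ 4)) ≤ 1 / 2 := by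
    rw [mul_zero, zero_mul, zero_mul]; norm_num
  have hsmallS : 12 * (0 : ℝ) * (0 : ℝ) ^ 2 * (ρ / (1 - ρ)) ≤ 1 / 2 := by norm_num
  -- the full-field gradient row: `GRADcov(Q j Y) ≤ 2·GRADcov(G_j) + 8d·MASS(∇^{cov}Λ_j)`
  obtain ⟨γ, hγ⟩ : ∃ γ : ℕ → ℝ, ∀ j, γ j = Real.sqrt (∑ t : Fin d → Fin (N' * L ^ (k - j)), ∑ κ : Fin d, ∑ ν : Fin d,
      ‖conjR (avgIter L U₀ j (boxVec (N' * L ^ (k - j)) t) ν) (Q j Y (boxVec (N' * L ^ (k - j)) t + e ν) κ) - Q j Y (boxVec (N' * L ^ (k - j)) t) κ‖ ^ 2) :=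
    ⟨_, fun _ => rfl⟩
  have hγrow : ∀ j ≤ k, γ j ^ 2 ≤ 2 * g j ^ 2 + 0 * (fun _ : ℕ => (0 : ℝ)) j ^ 2 + 8 * d * lam j ^ 2 := by
    intro j hj
    haveI : NeZero (Nc j) := ⟨(hNc0 j).ne'⟩
    have hV1 : ∀ x μ', avgIter L U₀ j x μ' ∈ U1 𝔸 := fun x μ' => unitaryUnits_le_U1 (hVu j hj x μ')
    obtain ⟨DΛ, hDΛ⟩ : ∃ D : LSite d → Fin d → 𝔸, ∀ (z : LSite d) (κ : Fin d), D z κ = Λ j z - conjR (avgIter L U₀ j z κ) (Λ j (z + e κ)) :=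
      ⟨fun z κ => Λ j z - conjR (avgIter L U₀ j z κ) (Λ j (z + e κ)), fun _ _ => rfl⟩
    have hF : Q j Y = Glin j + DΛ := by
      funext z κ
      have := hstruct j hj z κ
      rw [← hDΛ] at this
      exact this
    have hDΛP : ∀ (x : LSite d) (κ μ' : Fin d), DΛ (x + ((Nc j : ℕ) : ℤ) • e κ) μ' = DΛ x μ' := by
      intro x κ μ'
      rw [hDΛ, hDΛ, add_right_comm, apply_add_period_of_isPeriodic (hVper j hj) x κ μ', apply_add_period_of_isPeriodic' (hGlper j hj).2 x κ,
        apply_add_period_of_isPeriodic' (hGlper j hj).2 (x + e μ') κ]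
    have h1 := sum_cell_covGrad_add_le (Nc j) (avgIter L U₀ j) hV1 (Glin j) DΛ hDΛP
    have hγsq : γ j ^ 2 = ∑ t : Fin d → Fin (Nc j), ∑ κ : Fin d, ∑ ν : Fin d,
        ‖conjR (avgIter L U₀ j (boxVec (Nc j) t) ν) ((Glin j + DΛ) (boxVec (Nc j) t + e ν) κ) - (Glin j + DΛ) (boxVec (Nc j) t) κ‖ ^ 2 := by
      rw [hγ, Real.sq_sqrt (Finset.sum_nonneg fun _ _ => Finset.sum_nonneg fun _ _ => Finset.sum_nonneg fun _ _ => sq_nonneg _), hF]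
    have hgsq : g j ^ 2 = ∑ t : Fin d → Fin (Nc j), ∑ κ : Fin d, ∑ ν : Fin d,
        ‖conjR (avgIter L U₀ j (boxVec (Nc j) t) ν) (Glin j (boxVec (Nc j) t + e ν) κ) - Glin j (boxVec (Nc j) t) κ‖ ^ 2 := by
      rw [hg, Real.sq_sqrt (Finset.sum_nonneg fun _ _ => Finset.sum_nonneg fun _ _ => Finset.sum_nonneg fun _ _ => sq_nonneg _)]
    have hlsq : lam j ^ 2 = ∑ t : Fin d → Fin (Nc j), ∑ κ : Fin d, ‖DΛ (boxVec (Nc j) t) κ‖ ^ 2 := by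
      have eΛ : ∀ (t : Fin d → Fin (Nc j)) (κ : Fin d),
          ‖Λ j (boxVec (Nc j) t) - conjR (avgIter L U₀ j (boxVec (Nc j) t) κ) (Λ j (boxVec (Nc j) t + e κ))‖ ^ 2 = ‖DΛ (boxVec (Nc j) t) κ‖ ^ 2 :=
        fun t κ => by rw [hDΛ]
      rw [hlam, Real.sq_sqrt (Finset.sum_nonneg fun _ _ => Finset.sum_nonneg fun _ _ => sq_nonneg _)]
      exact Finset.sum_congr rfl fun t _ => Finset.sum_congr rfl fun κ _ => eΛ t κ
    rw [hγsq, hgsq, hlsq]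
    refine h1.trans (le_of_eq ?_)
    ring
  have hlines := n_lam_B_slot_of_rows hρ0 hρ1 hθ' hθg le_rfl hΘM hwG le_rfl le_rfl hcA hcB0 hcB1
    (fun j => 210 * ((2 * d + 2) * L) * α j * Real.sqrt (2 * d))
    (fun j => (24 * α j + 8 * (((d : ℝ) + 2) * L) ^ 2 * a j) * Real.sqrt (d * ((L : ℝ) ^ 2 * ((L : ℝ) ^ d)⁻¹)) + 210 * ((2 * d + 2) * L) * α j * Real.sqrt (8 * (d : ℝ) ^ 2))
    (fun _ => (0 : ℝ)) m (fun _ => (0 : ℝ)) g y lam wM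
    (fun j => by have := hα0 j; positivity) (fun j => by have := hα0 j; have := ha0 j; positivity) (fun _ => le_rfl)
    hm0' (fun _ => le_rfl) hg0' hlam0 hwM0 hκgeo hKgeo (fun j _ => by rw [zero_mul]) hwMgeo hmrec hgrec rfl
    (fun j _ => by rw [zero_mul, add_zero, mul_zero]) hyle hrow hsmall hsmallS hcB0sq hcB1sq hcAsq'
  have hgrad := grad_full_B_slot_of_rows hρ0 hρ1 hθ' hθg le_rfl hΘM hwG le_rfl le_rfl hcA hcB0 hcB1
    (fun j => 210 * ((2 * d + 2) * L) * α j * Real.sqrt (2 * d))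
    (fun j => (24 * α j + 8 * (((d : ℝ) + 2) * L) ^ 2 * a j) * Real.sqrt (d * ((L : ℝ) ^ 2 * ((L : ℝ) ^ d)⁻¹)) + 210 * ((2 * d + 2) * L) * α j * Real.sqrt (8 * (d : ℝ) ^ 2))
    (fun _ => (0 : ℝ)) m (fun _ => (0 : ℝ)) g y lam wM
    (fun j => by have := hα0 j; positivity) (fun j => by have := hα0 j; have := ha0 j; positivity) (fun _ => le_rfl)
    hm0' (fun _ => le_rfl) hg0' hlam0 hwM0 hκgeo hKgeo (fun j _ => by rw [zero_mul]) hwMgeo hmrec hgrec rfl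
    (fun j _ => by rw [zero_mul, add_zero, mul_zero]) hyle hrow hsmall hsmallS hcB0sq hcB1sq hcAsq'
    γ (by norm_num : (0 : ℝ) ≤ 2) le_rfl (by positivity : (0 : ℝ) ≤ 8 * d) hγrow
  intro l hl
  obtain ⟨_, _, hll⟩ := hlines l hl
  have hml : m l ≤ (Real.exp (θ' * (ρ ^ 3 / (1 - ρ ^ 4))) * m 0) * ρ ^ l := by
    have := mass_line_le_geom hρ0 hρ1 hθ' (fun j => 210 * ((2 * d + 2) * L) * α j * Real.sqrt (2 * d)) m
      (fun j => by have := hα0 j; positivity) hm0' hl (fun i hi => hκgeo i (by omega)) (fun i hi => hmrec i (by omega))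
    calc m l ≤ _ := this
      _ = _ := by ring
  refine ⟨?_, ?_⟩
  · -- MASS in two slots
    have hyl : y l ≤ (Real.exp (θ' * (ρ ^ 3 / (1 - ρ ^ 4))) * m 0) * ρ ^ l + (cB0 + cA * ρ ^ (2 * k)) * (ρ⁻¹) ^ l := by
      have hQn : (cB0 + cA * ρ ^ (2 * k) + cB1 * (2 * Real.exp (θ' * (ρ ^ 3 / (1 - ρ ^ 4))) * 0
          * ((Real.exp (θ' * (ρ ^ 3 / (1 - ρ ^ 4))) * m 0) * (ρ ^ (2 * k + 1) / (1 - ρ ^ 2)) + (cB0 + cA * ρ ^ (2 * k)) * (ρ ^ 3 / (1 - ρ ^ 4))))) * (ρ⁻¹) ^ l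
          = (cB0 + cA * ρ ^ (2 * k)) * (ρ⁻¹) ^ l := by ring
      rw [hQn] at hll
      have := hyle l hl
      have h0 : (fun _ : ℕ => (0 : ℝ)) l = 0 := rfl
      rw [h0, add_zero] at this
      linarith
    have h2 := sq_le_two_slot (hy0' l) hyl
    have hysq : y l ^ 2 = ∑ t : Fin d → Fin (N' * L ^ (k - l)), ∑ κ : Fin d, ‖Q l Y (boxVec (N' * L ^ (k - l)) t) κ‖ ^ 2 := by
      rw [hy, Real.sq_sqrt (Finset.sum_nonneg fun _ _ => Finset.sum_nonneg fun _ _ => sq_nonneg _)]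
    rw [hysq] at h2
    exact h2
  · -- GRADIENT in the pure B-slot
    have h := hgrad l hl
    have hγl : γ l ^ 2 = ∑ t : Fin d → Fin (N' * L ^ (k - l)), ∑ κ : Fin d, ∑ ν : Fin d,
        ‖conjR (avgIter L U₀ l (boxVec (N' * L ^ (k - l)) t) ν) (Q l Y (boxVec (N' * L ^ (k - l)) t + e ν) κ) - Q l Y (boxVec (N' * L ^ (k - l)) t) κ‖ ^ 2 := by
      rw [hγ, Real.sq_sqrt (Finset.sum_nonneg fun _ _ => Finset.sum_nonneg fun _ _ => Finset.sum_nonneg fun _ _ => sq_nonneg _)]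
    rw [hγl] at h
    refine h.trans (le_of_eq ?_)
    ring

end Summit.QuantumFields.YangMills.Theorems.Prop7CornerCombLinTowerCellRows

end
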